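import Literature.Probability.RandomPlanarGeometry.LoewnerRealKoebe
import Literature.Probability.RandomPlanarGeometry.SLETransienceSimple
import Mathlib.Topology.MetricSpace.Sequences
import HarnessLib

/-!
# Accesses of the origin at a real hitting time lie left of the driving point (Rohde–Schramm, Lemma 7.3)

Trunk T-STOCH, deterministic Loewner theory. In the proof of Lemma 7.3 of S. Rohde, O. Schramm,
*Basic properties of SLE*, Ann. of Math. 161 (2005), p. 910, at the first hitting time
`τ = τ(1)` of `[1, ∞)` by the trace one considers "the set `S` of limit points of `g_τ(z)` as
`z → 0` in `H_τ`" and uses "Then `S ⊂ (-∞, ξ(τ))`". Through the boundary extension `f̄_τ` of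
`g_τ⁻¹` (`Loewner.bdryInv`, `LoewnerBoundaryExtension`), `S` is the zero set of `f̄_τ` on `ℝ`
(the prime ends of `H_τ` at `0`). We **prove**, for the chain of ANY continuous driving function
`W` with `W 0 = 0`, generated by a curve `γ`, and a real point `p > 0` swallowed exactly at the
finite time `τ` (`T_p = τ`; at `τ = τ(1)`, `p = γ(τ)`):

* `Loewner.map_re_sub_driving_le_of_swallowingTime_eq` — **`g_τ(x) - W_τ ≤ x - p` for `x > p`**:
  the gap `g_s(x) - g_s(p)` of two real points on the same side is non-increasing in `s`
  (`IsSolution.sub_eq_mul_exp`), and `g_s(p) - W_s → 0` as `s ↑ τ = T_p` (continuity of the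
  frozen flow `realFlowStop`, which vanishes from `T_p` on);
* `Loewner.exists_map_ofReal_eq_of_driving_lt` — hence `g_τ` maps `(p, ∞)` ONTO `(W_τ, ∞)`
  (intermediate values), and
* `Loewner.IsGeneratedByCurve.bdryInv_ofReal_pos_of_driving_le` — **every prime end `v ≥ W_τ` is a
  real point `≥ p` (in particular `f̄_τ(v) ≠ 0`)**, given `f̄_τ(W_τ) = γ(τ) = p`:
  `f̄_τ(g_τ x) = x` (`bdryInv_map_ofReal_of_lt`);
* `Loewner.IsGeneratedByCurve.exists_accesses_le` — **the zero set of `f̄_τ` on `ℝ` lies in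
  `(-∞, W_τ - η]` for some `η > 0`** (it is closed, bounded — `|f̄_τ v - v|` is bounded,
  `exists_norm_bdryInv_ofReal_sub_self_le` — and contained in `(-∞, W_τ)`);
* `Loewner.IsGeneratedByCurve.accesses_le_of_near` — **persistence**: if every real zero of `f̄_τ`
  is `≤ W_τ - η`, the driving function moves by at most `η/4` on `[τ, τ + d]` and `64 d ≤ η²`,
  then every real zero of `f̄_{τ+d}` is `≤ W_{τ+d} - η/2` (cocycle `f_{τ+d} = f_τ ∘ f^{W(τ+·)}_d`,
  cluster points, and the far-field bounds `norm_map_sub_self_le_of_mem_domain`,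
  `lt_swallowingTime_of_far`; no curve is needed for the increment chain). This lets the Markov
  property be used at a fixed rational time slightly after `τ(1)`.

No topology of the two "sides" of the curve is needed: the statements follow from the
monotonicity of same-side gaps of the real flow and from far-field estimates.

## References

* S. Rohde, O. Schramm, *Basic properties of SLE*, Ann. of Math. 161 (2005), proof of Lemma 7.3
  (p. 910).
* G. F. Lawler, *Conformally Invariant Processes in the Plane*, AMS (2005), §4.1.
-/

noncomputable section

open Set Filter Topology Metric Complex Function
open UpperHalfPlane (upperHalfPlaneSet isOpen_upperHalfPlaneSet)
open scoped NNReal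

namespace Literature.Probability.RandomPlanarGeometry

namespace Loewner

variable {W : ℝ≥0 → ℝ} {γ : ℝ≥0 → ℂ}

/-! ### Same-side gaps decrease; the bound `g_τ(x) - W_τ ≤ x - p` -/

/-- **Same-side gaps of the real flow are non-increasing**: for `W 0 < p ≤ x` and `s < T_p`,
`g_s(x) - g_s(p) ≤ x - p` (two-point formula `IsSolution.sub_eq_mul_exp` with a non-positive
real exponent `∫ -2/(X P)`). [cite: Lawler2005, Thm. 4.6] -/
theorem map_re_sub_map_re_le (hW : Continuous W) {p x : ℝ} (hp : W 0 < p) (hpx : p ≤ x) {s : ℝ≥0}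
    (hs : (s : WithTop ℝ≥0) < swallowingTime W p) :
    (map W s x).re - (map W s p).re ≤ x - p := by
  rcases eq_or_lt_of_le hpx with rfl | hlt
  · simp
  have hx : W 0 < x := hp.trans hlt
  have hsx : (s : WithTop ℝ≥0) < swallowingTime W x := lt_of_lt_of_le hs (swallowingTime_mono_right hW hp hpx)
  have hx' : (x : ℂ) ≠ W 0 := fun h ↦ hx.ne' (by exact_mod_cast h)
  have hp' : (p : ℂ) ≠ W 0 := fun h ↦ hp.ne' (by exact_mod_cast h)
  obtain ⟨gx, hgx⟩ := exists_isSolution_swallowingTime_holds hW hx'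
  obtain ⟨gp, hgp⟩ := exists_isSolution_swallowingTime_holds hW hp'
  have hsTx := toNNReal_coe_lt hsx
  have hsTp := toNNReal_coe_lt hs
  have hsubx := Icc_subset_timeDomain (T := swallowingTime W x) hsTx
  have hsubp := Icc_subset_timeDomain (T := swallowingTime W p) hsTp
  have h2 := hgp.sub_eq_mul_exp hW hgx s.coe_nonneg hsTp hsTx
  have hint : (∫ u in (0:ℝ)..s, -2 / ((gx u - W u.toNNReal) * (gp u - W u.toNNReal))) =
      ((∫ u in (0:ℝ)..s, -2 / (realFlow W x u.toNNReal * realFlow W p u.toNNReal) : ℝ) : ℂ) := by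
    rw [← intervalIntegral.integral_ofReal]
    refine intervalIntegral.integral_congr fun u hu ↦ ?_
    rw [uIcc_of_le s.coe_nonneg] at hu
    rw [hgx.sub_driving_eq_ofReal_realFlow hW hu.1 (hsubx hu).2,
      hgp.sub_driving_eq_ofReal_realFlow hW hu.1 (hsubp hu).2]
    push_cast
    ring
  have hdiff : (map W s x).re - (map W s p).re =
      (x - p) * Real.exp (∫ u in (0:ℝ)..s, -2 / (realFlow W x u.toNNReal * realFlow W p u.toNNReal)) := by
    rw [map_eq_of_isSolution hW hgx hsx, map_eq_of_isSolution hW hgp hs]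
    have := congrArg Complex.re h2
    rw [hint, Complex.sub_re] at this
    rw [this, ← Complex.ofReal_exp, ← Complex.ofReal_sub, ← Complex.ofReal_mul, Complex.ofReal_re]
  rw [hdiff]
  have hexp : Real.exp (∫ u in (0:ℝ)..s, -2 / (realFlow W x u.toNNReal * realFlow W p u.toNNReal)) ≤ 1 := by
    refine Real.exp_le_one_iff.2 ?_
    have h : 0 ≤ ∫ u in (0:ℝ)..s, -(-2 / (realFlow W x u.toNNReal * realFlow W p u.toNNReal)) := by
      refine intervalIntegral.integral_nonneg s.coe_nonneg fun u hu ↦ ?_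
      have huT : ((u.toNNReal : ℝ≥0) : WithTop ℝ≥0) < swallowingTime W p :=
        lt_of_le_of_lt (WithTop.coe_le_coe.2 (Real.toNNReal_le_iff_le_coe.2 hu.2)) hs
      have huTx : ((u.toNNReal : ℝ≥0) : WithTop ℝ≥0) < swallowingTime W x :=
        lt_of_lt_of_le huT (swallowingTime_mono_right hW hp hpx)
      have h1 := realFlow_pos hW hx huTx
      have h2 := realFlow_pos hW hp huT
      rw [neg_div, neg_neg]
      positivity
    rw [intervalIntegral.integral_neg] at h
    linarith
  nlinarith [sub_pos.2 hlt]

/-- **`g_τ(x) - W_τ ≤ x - p` for `x > p` when `p` is swallowed exactly at `τ`** (Rohde–Schramm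
(2005), proof of Lemma 7.3, the step "`S ⊂ (-∞, ξ(τ))`", in flow form): for `s < τ`,
`g_s(x) - W_s ≤ (g_s(p) - W_s) + (x - p)` by `map_re_sub_map_re_le`, and `g_s(p) - W_s → 0` as
`s ↑ τ` (the frozen flow `realFlowStop W p` is continuous and vanishes at `T_p = τ`), while
`g_s(x) - W_s → g_τ(x) - W_τ` (`x` is alive at `τ`). [cite: RohdeSchramm2005, proof of Lemma 7.3 (p. 910)] -/
theorem map_re_sub_driving_le_of_swallowingTime_eq (hW : Continuous W) {p x : ℝ} (hp : W 0 < p)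
    (hpx : p < x) {τ : ℝ≥0} (hτ : swallowingTime W p = τ) (hτx : (τ : WithTop ℝ≥0) < swallowingTime W x) :
    (map W τ x).re - W τ ≤ x - p := by
  have hx : W 0 < x := hp.trans hpx
  -- `τ > 0`
  have hτ0 : 0 < τ := by
    have h0 : (0 : WithTop ℝ≥0) < swallowingTime W p :=
      swallowingTime_pos_holds hW (fun h ↦ hp.ne' (by exact_mod_cast h))
    rw [hτ] at h0
    exact_mod_cast h0
  haveI : (𝓝[<] τ).NeBot := nhdsLT_neBot_of_exists_lt ⟨0, hτ0⟩
  -- along `s ↑ τ`: `X_s ≤ P_s + (x - p)`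
  have hev : ∀ᶠ s in 𝓝[<] τ, realFlowStop W x s ≤ realFlowStop W p s + (x - p) := by
    filter_upwards [self_mem_nhdsWithin] with s hs
    have hs' : (s : WithTop ℝ≥0) < swallowingTime W p := by rw [hτ]; exact WithTop.coe_lt_coe.2 hs
    have hsx : (s : WithTop ℝ≥0) < swallowingTime W x := lt_of_lt_of_le hs' (swallowingTime_mono_right hW hp hpx.le)
    rw [realFlowStop_of_lt hs', realFlowStop_of_lt hsx, realFlow_apply, realFlow_apply]
    linarith [map_re_sub_map_re_le hW hp hpx.le hs']
  -- limits of both sides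
  have hcx : Continuous (realFlowStop W x) := continuous_realFlowStop_of_ne hW hx.ne'
  have hcp : Continuous (realFlowStop W p) := continuous_realFlowStop_of_ne hW hp.ne'
  have hlimx : Tendsto (realFlowStop W x) (𝓝[<] τ) (𝓝 (realFlowStop W x τ)) :=
    (hcx.tendsto τ).mono_left nhdsWithin_le_nhds
  have hlimp : Tendsto (fun s ↦ realFlowStop W p s + (x - p)) (𝓝[<] τ) (𝓝 (realFlowStop W p τ + (x - p))) :=
    ((hcp.tendsto τ).mono_left nhdsWithin_le_nhds).add_const _
  have hle := le_of_tendsto_of_tendsto hlimx hlimp hev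
  have hp0 : realFlowStop W p τ = 0 := realFlowStop_of_le (by rw [hτ])
  have hxτ : realFlowStop W x τ = realFlow W x τ := realFlowStop_of_lt hτx
  rw [hp0, hxτ, realFlow_apply, zero_add] at hle
  exact hle

/-- **`g_τ` maps `(p, ∞)` onto `(W_τ, ∞)`** when `p` is swallowed exactly at `τ`: every real
`v > W_τ` is `g_τ(x)` for some `x > p` alive at `τ` (intermediate values between
`g_τ(x) - W_τ ≤ x - p → 0` and `g_τ(x) ≥ x → ∞`). [cite: RohdeSchramm2005, proof of Lemma 7.3 (p. 910)] -/
theorem exists_map_ofReal_eq_of_driving_lt (hW : Continuous W) {p : ℝ} (hp : W 0 < p) {τ : ℝ≥0}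
    (hτ : swallowingTime W p = τ) (halive : ∀ x : ℝ, p < x → (τ : WithTop ℝ≥0) < swallowingTime W x)
    {v : ℝ} (hv : W τ < v) :
    ∃ x : ℝ, p < x ∧ (τ : WithTop ℝ≥0) < swallowingTime W x ∧ map W τ x = v := by
  -- a point `x₁ > p` with `g_τ(x₁) < v` and a point `x₂` with `g_τ(x₂) ≥ v`
  set x₁ : ℝ := p + (v - W τ) / 2 with hx₁
  have hpx₁ : p < x₁ := by simp only [hx₁]; linarith
  have h1 : (map W τ x₁).re < v := by
    have := map_re_sub_driving_le_of_swallowingTime_eq hW hp hpx₁ hτ (halive x₁ hpx₁)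
    simp only [hx₁] at this ⊢
    linarith
  set x₂ : ℝ := max x₁ v with hx₂
  have hx₁x₂ : x₁ ≤ x₂ := le_max_left _ _
  have hpx₂ : p < x₂ := hpx₁.trans_le hx₁x₂
  have h2 : v ≤ (map W τ x₂).re :=
    (le_max_right x₁ v).trans (self_le_map_ofReal_re hW (hp.trans hpx₂) (halive x₂ hpx₂))
  -- intermediate value theorem on `[x₁, x₂]`
  set φ : ℝ → ℝ := fun u ↦ (map W τ u).re with hφ
  have hφc : ContinuousOn φ (Icc x₁ x₂) := by
    intro u hu
    have hτu := halive u (hpx₁.trans_le hu.1)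
    exact (Complex.continuous_re.continuousAt.comp ((continuousAt_map hW hτu).comp
      Complex.continuous_ofReal.continuousAt)).continuousWithinAt
  obtain ⟨x, hx, hxv⟩ := intermediate_value_Icc hx₁x₂ hφc ⟨h1.le, h2⟩
  have hpx : p < x := hpx₁.trans_le hx.1
  refine ⟨x, hpx, halive x hpx, ?_⟩
  rw [map_ofReal_eq hW (halive x hpx)]
  exact Complex.ext (by simpa [hφ] using hxv) (by simp)

/-! ### Boundary values: prime ends right of the driving point are real points right of `p` -/

/-- **`f̄_t(g_t x) = x` for a real point `x` alive at time `t`** (chain generated by a curve):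
`f̄_t` is the limit of `f_t` within `ℍₒ` at `g_t x`, and along `g_t(x + i/(n+1)) → g_t(x)` the
values are `x + i/(n+1) → x`. [folklore] -/
theorem IsGeneratedByCurve.bdryInv_map_ofReal_of_lt (hγ : IsGeneratedByCurve W γ) (hW : Continuous W)
    {x : ℝ} {t : ℝ≥0} (ht : (t : WithTop ℝ≥0) < swallowingTime W x) (him : (map W t x).im = 0) :
    bdryInv W t (map W t x) = x := by
  -- points above `x` are in `H_t` eventually
  have hopen : IsOpen {z : ℂ | (t : WithTop ℝ≥0) < swallowingTime W z} := isOpen_setOf_lt_swallowingTime hW t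
  obtain ⟨r, hr, hball⟩ := Metric.isOpen_iff.1 hopen x ht
  set z : ℕ → ℂ := fun n ↦ (x : ℂ) + I * ((r / 2) / (n + 1) : ℝ) with hz
  have hzim : ∀ n, 0 < (z n).im := fun n ↦ by
    simp only [hz, Complex.add_im, Complex.ofReal_im, Complex.mul_im, Complex.I_re, Complex.I_im,
      Complex.ofReal_re, zero_mul, one_mul, zero_add]
    positivity
  have hzmem : ∀ n, z n ∈ domain W t := by
    intro n
    refine (mem_domain_iff W t _).2 ⟨hzim n, hball ?_⟩
    rw [Metric.mem_ball, dist_eq_norm, hz, add_sub_cancel_left, norm_mul, Complex.norm_I, one_mul,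
      Complex.norm_real, Real.norm_eq_abs, abs_of_pos (by positivity)]
    have : (r / 2) / ((n : ℝ) + 1) ≤ r / 2 := div_le_self (by positivity) (by linarith [n.cast_nonneg (α := ℝ)])
    linarith
  have hzlim : Tendsto z atTop (𝓝 (x : ℂ)) := by
    have h1 : Tendsto (fun n : ℕ ↦ (r / 2) / ((n : ℝ) + 1)) atTop (𝓝 0) := by
      have := tendsto_one_div_add_atTop_nhds_zero_nat.const_mul (r / 2)
      rw [mul_zero] at this
      refine this.congr fun n ↦ ?_
      ring
    have h2 : Tendsto (fun n : ℕ ↦ (x : ℂ) + I * (((r / 2) / ((n : ℝ) + 1) : ℝ) : ℂ)) atTop (𝓝 ((x : ℂ) + I * ((0 : ℝ) : ℂ))) :=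
      tendsto_const_nhds.add (tendsto_const_nhds.mul ((Complex.continuous_ofReal.tendsto 0).comp h1))
    rw [Complex.ofReal_zero, mul_zero, add_zero] at h2
    exact h2
  -- `g_t (z n) → g_t x` within `ℍₒ`, and `f_t (g_t (z n)) = z n → x`
  have hglim : Tendsto (fun n ↦ map W t (z n)) atTop (𝓝[upperHalfPlaneSet] (map W t x)) := by
    refine tendsto_nhdsWithin_iff.2 ⟨((continuousAt_map hW ht).tendsto.comp hzlim), Eventually.of_forall fun n ↦ ?_⟩
    exact mapsTo_map hW t (hzmem n)
  have h1 : Tendsto (fun n ↦ loewnerInv W t (map W t (z n))) atTop (𝓝 (bdryInv W t (map W t x))) :=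
    (hγ.tendsto_bdryInv hW t (le_of_eq him.symm)).comp hglim
  have h2 : Tendsto (fun n ↦ loewnerInv W t (map W t (z n))) atTop (𝓝 (x : ℂ)) :=
    hzlim.congr fun n ↦ (loewnerInv_map hW (hzmem n)).symm
  exact tendsto_nhds_unique h1 h2

/-- **Prime ends right of the driving point are real points right of `p`**: let the chain of the
continuous `W` (`W 0 = 0`) be generated by `γ`, let `p > 0` be swallowed exactly at `τ` with all
`x > p` alive at `τ` (e.g. `p = γ(τ)` the first point of `[1, ∞)` on the curve), and suppose
`f̄_τ(W_τ) = p`-or-not: then for every real `v > W_τ`, `f̄_τ(v)` is a real number `> p`.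
[cite: RohdeSchramm2005, proof of Lemma 7.3 (p. 910)] -/
theorem IsGeneratedByCurve.bdryInv_ofReal_eq_of_driving_lt (hγ : IsGeneratedByCurve W γ) (hW : Continuous W)
    {p : ℝ} (hp : W 0 < p) {τ : ℝ≥0} (hτ : swallowingTime W p = τ)
    (halive : ∀ x : ℝ, p < x → (τ : WithTop ℝ≥0) < swallowingTime W x) {v : ℝ} (hv : W τ < v) :
    ∃ x : ℝ, p < x ∧ bdryInv W τ v = x := by
  obtain ⟨x, hpx, hτx, hxv⟩ := exists_map_ofReal_eq_of_driving_lt hW hp hτ halive hv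
  refine ⟨x, hpx, ?_⟩
  rw [← hxv]
  exact hγ.bdryInv_map_ofReal_of_lt hW hτx (by rw [hxv]; simp)

/-- `|f̄_t v - v|` is bounded on the closed half-plane by the bound on the open half-plane
(`exists_norm_bdryInv_sub_self_le`) and continuity of `f̄_t`. [folklore] -/
theorem IsGeneratedByCurve.exists_norm_bdryInv_ofReal_sub_self_le (hγ : IsGeneratedByCurve W γ)
    (hW : Continuous W) (t : ℝ≥0) : ∃ C : ℝ, ∀ v : ℝ, ‖bdryInv W t v - v‖ ≤ C := by
  obtain ⟨C, hC⟩ := exists_norm_bdryInv_sub_self_le hW t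
  refine ⟨C, fun v ↦ ?_⟩
  set w : ℕ → ℂ := fun n ↦ (v : ℂ) + I * ((1 : ℝ) / (n + 1) : ℝ) with hw
  have hwim : ∀ n, 0 < (w n).im := fun n ↦ by
    simp only [hw, Complex.add_im, Complex.ofReal_im, Complex.mul_im, Complex.I_re, Complex.I_im,
      Complex.ofReal_re, zero_mul, one_mul, zero_add]
    positivity
  have hwlim : Tendsto w atTop (𝓝 (v : ℂ)) := by
    have h2 : Tendsto (fun n : ℕ ↦ (v : ℂ) + I * (((1 : ℝ) / ((n : ℝ) + 1) : ℝ) : ℂ)) atTop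
        (𝓝 ((v : ℂ) + I * ((0 : ℝ) : ℂ))) :=
      tendsto_const_nhds.add (tendsto_const_nhds.mul ((Complex.continuous_ofReal.tendsto 0).comp
        tendsto_one_div_add_atTop_nhds_zero_nat))
    rw [Complex.ofReal_zero, mul_zero, add_zero] at h2
    exact h2
  have hlim : Tendsto (fun n ↦ bdryInv W t (w n) - w n) atTop (𝓝 (bdryInv W t v - v)) := by
    refine Tendsto.sub ?_ hwlim
    refine ((hγ.continuousOn_bdryInv hW t) v (by simp)).tendsto.comp ?_
    exact tendsto_nhdsWithin_iff.2 ⟨hwlim, Eventually.of_forall fun n ↦ (hwim n).le⟩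
  exact le_of_tendsto hlim.norm (Eventually.of_forall fun n ↦ hC _ (hwim n))

/-- **The accesses of `0` lie in `(-∞, W_τ - η]`** (Rohde–Schramm (2005), proof of Lemma 7.3:
"`S ⊂ (-∞, ξ(τ))`", made quantitative by compactness): let the chain of the continuous `W` with
`W 0 = 0` be generated by `γ`, `p > 0` swallowed exactly at `τ` with all `x > p` alive at `τ`, and
`f̄_τ(W_τ) ≠ 0` (at `τ = τ(1)`: `f̄_τ(W_τ) = γ(τ) = p`). Then there is `η > 0` such that every
real `v` with `f̄_τ(v) = 0` satisfies `v ≤ W_τ - η`: no zero lies at or right of `W_τ`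
(`bdryInv_ofReal_eq_of_driving_lt`), and the zero set of the continuous `f̄_τ` on `ℝ` is closed and
bounded. [cite: RohdeSchramm2005, proof of Lemma 7.3 (p. 910)] -/
theorem IsGeneratedByCurve.exists_accesses_le (hγ : IsGeneratedByCurve W γ) (hW : Continuous W)
    (hW0 : W 0 = 0) {p : ℝ} (hp : 0 < p) {τ : ℝ≥0} (hτ : swallowingTime W p = τ)
    (halive : ∀ x : ℝ, p < x → (τ : WithTop ℝ≥0) < swallowingTime W x) (htip : bdryInv W τ (W τ) ≠ 0) :
    ∃ η : ℝ, 0 < η ∧ ∀ v : ℝ, bdryInv W τ v = 0 → v ≤ W τ - η := by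
  have hp' : W 0 < p := by rw [hW0]; exact hp
  -- no zero at or right of `W τ`
  have hright : ∀ v : ℝ, W τ ≤ v → bdryInv W τ v ≠ 0 := by
    intro v hv h0
    rcases hv.eq_or_lt with h | h
    · exact htip (by rw [h]; exact h0)
    · obtain ⟨x, hpx, hx⟩ := hγ.bdryInv_ofReal_eq_of_driving_lt hW hp' hτ halive h
      rw [hx] at h0
      have hx0 : x = 0 := by exact_mod_cast h0
      linarith
  -- the zero set is closed and bounded
  set Z : Set ℝ := {v : ℝ | bdryInv W τ v = 0} with hZ
  have hcont : Continuous fun v : ℝ ↦ bdryInv W τ v :=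
    (hγ.continuousOn_bdryInv hW τ).comp_continuous Complex.continuous_ofReal fun v ↦ by simp
  have hZc : IsClosed Z := isClosed_eq hcont continuous_const
  obtain ⟨C, hC⟩ := hγ.exists_norm_bdryInv_ofReal_sub_self_le hW τ
  have hZb : Bornology.IsBounded Z := by
    refine (Metric.isBounded_closedBall (x := (0 : ℝ)) (r := C)).subset fun v hv ↦ ?_
    rw [Metric.mem_closedBall, dist_zero_right, Real.norm_eq_abs]
    have h := hC v
    rw [show bdryInv W τ v = 0 from hv, zero_sub, norm_neg, Complex.norm_real, Real.norm_eq_abs] at h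
    exact h
  rcases Z.eq_empty_or_nonempty with hZe | hZne
  · refine ⟨1, one_pos, fun v hv ↦ ?_⟩
    have : v ∈ Z := hv
    rw [hZe] at this
    exact absurd this (notMem_empty v)
  · have hZcpt : IsCompact Z := Metric.isCompact_of_isClosed_isBounded hZc hZb
    have hsup : sSup Z ∈ Z := hZcpt.sSup_mem hZne
    have hlt : sSup Z < W τ := by
      by_contra hle
      exact hright _ (not_lt.1 hle) hsup
    refine ⟨W τ - sSup Z, sub_pos.2 hlt, fun v hv ↦ ?_⟩
    have : v ≤ sSup Z := le_csSup hZcpt.bddAbove hv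
    linarith

/-! ### Persistence of the accesses bound shortly after `τ` -/

/-- **The accesses of `0` stay left of the driving point shortly after `τ`.** Let the chain of
the continuous `W` be generated by `γ`, and suppose that at time `τ` every real zero of `f̄_τ`
is `≤ W_τ - η` (`η > 0`). If on `[τ, q]` the driving function moves by at most `η/4` and
`64 (q - τ) ≤ η²`, then every real zero `v` of `f̄_q` is `≤ W_q - η/2`. Proof: `f_q = f_τ ∘ f^V_d`
on `ℍₒ` (`V = W(τ + ·)`, `d = q - τ`, `loewnerInv_add`); for `wₙ → v` in `ℍₒ` the points
`uₙ = f^V_d(wₙ)` stay bounded (`norm_map_sub_self_le_of_mem_domain`) and `f_τ(uₙ) → 0`, so a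
cluster point `u` is a real zero of `f̄_τ`, `u ≤ W_τ - η`; it is far from the increment hull, hence
alive for the chain of `V` with `|g^V_d(u) - u| ≤ 8(q-τ)/η` (`lt_swallowingTime_of_far`), and
`v = g^V_d(u)`. This is the deterministic step that lets the conformal Markov property be applied
at a fixed (rational) time slightly after `τ(1)` in Rohde–Schramm's proof of Lemma 7.3.
[cite: RohdeSchramm2005, proof of Lemma 7.3 (p. 910)] -/
theorem IsGeneratedByCurve.accesses_le_of_near (hγ : IsGeneratedByCurve W γ) (hW : Continuous W)
    {τ d : ℝ≥0} {η : ℝ} (hη : 0 < η)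
    (hacc : ∀ v : ℝ, bdryInv W τ v = 0 → v ≤ W τ - η)
    (hosc : ∀ u : ℝ≥0, u ≤ d → |W (τ + u) - W τ| ≤ η / 4)
    (hd : 64 * (d : ℝ) ≤ η ^ 2) :
    ∀ v : ℝ, bdryInv W (τ + d) v = 0 → v ≤ W (τ + d) - η / 2 := by
  intro v hv
  set V : ℝ≥0 → ℝ := fun u ↦ W (τ + u) with hV
  have hVc : Continuous V := continuous_shift W hW τ
  -- the vertical sequence `w n → v` and `u n = f^V_d (w n)`
  set w : ℕ → ℂ := fun n ↦ (v : ℂ) + I * ((1 : ℝ) / (n + 1) : ℝ) with hw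
  have hwim : ∀ n, 0 < (w n).im := fun n ↦ by
    simp only [hw, Complex.add_im, Complex.ofReal_im, Complex.mul_im, Complex.I_re, Complex.I_im,
      Complex.ofReal_re, zero_mul, one_mul, zero_add]
    positivity
  have hwlim : Tendsto w atTop (𝓝 (v : ℂ)) := by
    have h2 : Tendsto (fun n : ℕ ↦ (v : ℂ) + I * (((1 : ℝ) / ((n : ℝ) + 1) : ℝ) : ℂ)) atTop
        (𝓝 ((v : ℂ) + I * ((0 : ℝ) : ℂ))) :=
      tendsto_const_nhds.add (tendsto_const_nhds.mul ((Complex.continuous_ofReal.tendsto 0).comp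
        tendsto_one_div_add_atTop_nhds_zero_nat))
    rw [Complex.ofReal_zero, mul_zero, add_zero] at h2
    exact h2
  set u : ℕ → ℂ := fun n ↦ loewnerInv V d (w n) with hu
  have huim : ∀ n, 0 < (u n).im := fun n ↦ im_loewnerInv_pos hVc d (hwim n)
  have hudom : ∀ n, u n ∈ domain V d := fun n ↦ loewnerInv_mem_domain hVc d (hwim n)
  have hmapu : ∀ n, map V d (u n) = w n := fun n ↦ map_loewnerInv hVc d (hwim n)
  have hcocycle : ∀ n, loewnerInv W (τ + d) (w n) = loewnerInv W τ (u n) := fun n ↦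
    loewnerInv_add hW τ d (hwim n)
  -- `f_τ (u n) → 0`
  have hfτ : Tendsto (fun n ↦ loewnerInv W τ (u n)) atTop (𝓝 0) := by
    have h1 : Tendsto (fun n ↦ loewnerInv W (τ + d) (w n)) atTop (𝓝 (bdryInv W (τ + d) v)) := by
      refine (hγ.tendsto_bdryInv hW (τ + d) (by simp : (0 : ℝ) ≤ ((v : ℂ)).im)).comp ?_
      exact tendsto_nhdsWithin_iff.2 ⟨hwlim, Eventually.of_forall fun n ↦ hwim n⟩
    rw [hv] at h1
    exact h1.congr fun n ↦ hcocycle n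
  -- the `u n` are bounded: `|w n - u n| ≤ 2(η/4) + 13√d`
  have hM : ∀ s ∈ Icc (0 : ℝ) d, ‖(V s.toNNReal : ℂ) - (W τ : ℂ)‖ ≤ η / 4 := by
    intro s hs
    rw [← Complex.ofReal_sub, Complex.norm_real, Real.norm_eq_abs]
    exact hosc s.toNNReal (Real.toNNReal_le_iff_le_coe.2 hs.2)
  have hbd : ∀ n, ‖w n - u n‖ ≤ 2 * (η / 4) + 13 * Real.sqrt d := fun n ↦ by
    have h := norm_map_sub_self_le_of_mem_domain hVc hM (hudom n)
    rwa [hmapu n] at h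
  have hubdd : ∀ᶠ n in atTop, u n ∈ closedBall (v : ℂ) (1 + (2 * (η / 4) + 13 * Real.sqrt d)) := by
    have hev : ∀ᶠ n in atTop, ‖w n - v‖ < 1 := by
      have := (tendsto_iff_norm_sub_tendsto_zero.1 hwlim).eventually (gt_mem_nhds one_pos)
      simpa using this
    filter_upwards [hev] with n hn
    rw [mem_closedBall, dist_eq_norm]
    calc ‖u n - v‖ = ‖(w n - v) - (w n - u n)‖ := by ring_nf
      _ ≤ ‖w n - v‖ + ‖w n - u n‖ := norm_sub_le _ _
      _ ≤ 1 + (2 * (η / 4) + 13 * Real.sqrt d) := by linarith [hbd n]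
  obtain ⟨ulim, -, φ, hφ, hconv⟩ := tendsto_subseq_of_frequently_bounded isBounded_closedBall hubdd.frequently
  have hulim_im : 0 ≤ ulim.im :=
    (isClosed_le continuous_const Complex.continuous_im).mem_of_tendsto hconv
      (Eventually.of_forall fun n ↦ (huim (φ n)).le)
  -- `f̄_τ ulim = 0`, hence `ulim` is real with `re ulim ≤ W τ - η`
  have hFlim : bdryInv W τ ulim = 0 := by
    have h1 : Tendsto (fun n ↦ loewnerInv W τ (u (φ n))) atTop (𝓝 (bdryInv W τ ulim)) := by
      refine (hγ.tendsto_bdryInv hW τ hulim_im).comp ?_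
      exact tendsto_nhdsWithin_iff.2 ⟨hconv, Eventually.of_forall fun n ↦ huim (φ n)⟩
    exact tendsto_nhds_unique h1 (hfτ.comp hφ.tendsto_atTop)
  have hreal : ulim.im = 0 := by
    refine le_antisymm (not_lt.1 fun hpos ↦ ?_) hulim_im
    have hmem : bdryInv W τ ulim ∈ domain W τ := bdryInv_mem_domain hW τ hpos
    have : (0 : ℝ) < (bdryInv W τ ulim).im := hmem.1
    rw [hFlim, Complex.zero_im] at this
    exact lt_irrefl _ this
  have hulim_eq : ulim = ((ulim.re : ℝ) : ℂ) := Complex.ext (by simp) (by simp [hreal])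
  have hacc' : ulim.re ≤ W τ - η := hacc ulim.re (by rw [← hulim_eq]; exact hFlim)
  -- `ulim` is far from the increment hull: alive, and moved little by `g^V_d`
  have hη4 : 0 < η / 4 := by positivity
  have hδt : 4 * (d : ℝ) ≤ (η / 4) ^ 2 := by nlinarith
  have hfar : η / 4 + 2 * (η / 4) ≤ ‖ulim - (W τ : ℂ)‖ := by
    have h1 : |ulim.re - W τ| ≤ ‖ulim - (W τ : ℂ)‖ := by
      have := Complex.abs_re_le_norm (ulim - (W τ : ℂ))
      simpa using this
    have h2 : η ≤ |ulim.re - W τ| := by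
      rw [abs_sub_comm, abs_of_nonneg (by linarith)]
      linarith
    linarith
  obtain ⟨halive, hmove⟩ := lt_swallowingTime_of_far hVc (t := d) hM hη4 hδt hfar
  have hmove' := (hmove d le_rfl).2
  -- `v = g^V_d ulim`
  have hveq : (v : ℂ) = map V d ulim := by
    have h1 : Tendsto (fun n ↦ map V d (u (φ n))) atTop (𝓝 (map V d ulim)) :=
      ((continuousAt_map hVc halive).tendsto).comp hconv
    have h2 : Tendsto (fun n ↦ map V d (u (φ n))) atTop (𝓝 (v : ℂ)) :=
      (hwlim.comp hφ.tendsto_atTop).congr fun n ↦ (hmapu (φ n)).symm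
    exact tendsto_nhds_unique h2 h1
  -- conclude
  have hre : v - ulim.re ≤ 2 / (η / 4) * d := by
    have h1 : |(map V d ulim - ulim).re| ≤ ‖map V d ulim - ulim‖ := Complex.abs_re_le_norm _
    have h2 : (map V d ulim - ulim).re = v - ulim.re := by
      rw [← hveq, Complex.sub_re, Complex.ofReal_re]
    rw [h2] at h1
    exact (le_abs_self _).trans (h1.trans hmove')
  have hWq : |W (τ + d) - W τ| ≤ η / 4 := hosc d le_rfl
  have h32 : 2 / (η / 4) * (d : ℝ) ≤ η / 4 := by
    rw [div_mul_eq_mul_div, div_le_iff₀ hη4]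
    nlinarith
  rw [abs_le] at hWq
  show v ≤ V d - η / 2
  have : V d = W (τ + d) := rfl
  linarith [hWq.1]

end Loewner

end Literature.Probability.RandomPlanarGeometry
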